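import Summits.CriticalPhenomena.SAWScalingLimit.Theses.SAWCircleScreening
import Literature.Probability.RandomPlanarGeometry.SLEExistenceNeEightHolds
import HarnessLib

/-!
# `ChordalSLE83Exists` (route SAWCircleScreening, item stmt-CriticalPhenomena-6981) — proved

Chordal SLE_{8/3} exists as a random curve in every Dobrushin domain:
`∀ D, ∃ Γ, IsSLECurve (8/3) D Γ`.

This is the `κ = 8/3` instance of the named fact
`Literature.Probability.RandomPlanarGeometry.exists_isSLECurve`, and that instance is already an
unconditional theorem of the tree:
`Literature.Probability.RandomPlanarGeometry.exists_isSLECurve_eightThirds`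
(`SLEExistenceNeEightHolds.lean`), assembled from Rohde–Schramm (2005) Thm. 5.1 (the SLE_κ trace
exists for `κ ≠ 8`, `hasSLETrace_of_ne_eight_apply`, itself from the proved Cor. 3.5
`RohdeSchramm2005_cor35_holds`), Thm. 7.1 (transience, `tendsto_norm_sleTrace_atTop_of_ne_eight`)
and the Riemann-mapping / Carathéodory assembly `exists_isSLECurve_at`. No hypothesis of the
route is used; the proof is definitional unfolding plus that theorem.

References: S. Rohde, O. Schramm, *Basic properties of SLE*, Ann. of Math. 161 (2005),
Thm. 5.1 and Thm. 7.1; G. F. Lawler, *Conformally Invariant Processes in the Plane* (2005), §6.3.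
-/

namespace Summit.CriticalPhenomena.SAWScalingLimit.Theorems

/-- **`ChordalSLE83Exists` holds** (item stmt-CriticalPhenomena-6981 of route
SAWCircleScreening): for every Dobrushin domain `D` there is a chordal SLE_{8/3} random curve
`Γ : (ℝ≥0 → ℝ) → CurveClass ℂ` in `D`, i.e. `IsSLECurve (8/3) D Γ`. Immediate from the tree
theorem `Literature.Probability.RandomPlanarGeometry.exists_isSLECurve_eightThirds`
(Rohde–Schramm 2005, Thm. 5.1 and Thm. 7.1, both discharged in the tree for `κ ≠ 8`). -/
theorem ChordalSLE83Exists_proof :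
    Summit.CriticalPhenomena.SAWScalingLimit.Theses.SAWCircleScreening.ChordalSLE83Exists := by
  unfold Summit.CriticalPhenomena.SAWScalingLimit.Theses.SAWCircleScreening.ChordalSLE83Exists
  intro D
  exact Literature.Probability.RandomPlanarGeometry.exists_isSLECurve_eightThirds D

end Summit.CriticalPhenomena.SAWScalingLimit.Theorems
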